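import Summits.HubbardSuperconductivity.HubbardSuperconductivity.Theorems.KLProgrammeKLRegimeScaleZeroCovarianceTorusPeriodisation
import Summits.HubbardSuperconductivity.HubbardSuperconductivity.Theorems.KLProgrammeKLRegimeScaleZeroMatsubaraWindowTruncation
import Literature.Analysis.SpecialFunctions.MatsubaraSum

/-!
# Route `KLProgramme`, crux K3 — engine-flow child (stmt-HubbardSuperconductivity-20437), stub (C) at `n = 0`, located item #22a «(C)-SCALE0-PT2»,
# §2a (M) OFF SITE: a momentum-independent symbol is invisible, the spatial factor of every frequency is `O(1/m(ω)²)` uniformly in `L`,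
# and the engine's frequency WINDOW differs from the full Matsubara series by `O(β/M)`

Cell gate-hubbard-kl, seat p1 g20 (supplier of #22a; SPEC v2 §2a (M)).  Objects (all from the tree, no definition is introduced): the torus characters
`torusChar` and their orthogonality `sum_torusChar_left`, the UV symbol `uvSymbolFn c Λ e ω = χ₂((ω²+e²)/Λ²)·c/(−iω+e)` with its band derivative bound
`norm_uvSymbolFnXiD1_le` (`‖∂_eΨ‖ ≤ (2B₁+1)c/m(ω)²`, `m(ω) = max(|ω|, Λ/2)`, `B₁ ≥ |χ₂′|`), and the frequency-by-frequency form of the scale-`0`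
covariance entry `gridCov_uvSymbolCT_apply_zero_one_eq_sum_freq` (`…ScaleZeroCovarianceTorusPeriodisation`).

* §1 `sum_torusChar_mul_eq_sum_torusChar_mul_sub`, **`norm_sum_torusChar_mul_le_of_ne_zero`** — OFF SITE (`z̄ ≠ 0`) any reference value may be
  subtracted from the symbol: `‖Σ_k χ_k(z̄)F(k)‖ ≤ Σ_k ‖F(k) − a‖`;
* §2 **`norm_uvSymbolFn_sub_uvSymbolFn_le`** — the UV symbol is Lipschitz in the band: `‖Ψ(ω,e) − Ψ(ω,e′)‖ ≤ (2B₁+1)c/m(ω)²·|e − e′|` (every real `ω`);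
* §3 **`norm_sum_torusChar_mul_uvSymbolFn_le_of_ne_zero`** — hence for `z̄ ≠ 0` and a band with `|e(k)| ≤ E`:
  `‖Σ_k χ_k(z̄)·Ψ(ω, e(k))‖ ≤ L²·((2B₁+1)c/m(ω)²·E)` for EVERY frequency, uniformly in `L` (the `1/ω` part of the symbol is spatially local);
  `norm_freqTerm_le_of_ne_zero` — in the entry's normalisation `(βL²)⁻²·|e^{iωΔτ}|·‖S_L(ω)‖ ≤ (2B₁+1)E/(β·m(ω)²)` (at the Matsubara
  frequencies `≤ (2B₁+1)Eβ/(π²(2n+1)²)`: summable over ALL frequencies);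
* §4 `sum_matsubaraIdx_freq_eq_sum_Ico` — the engine's frequency set `MatsubaraIdx M` is the integer window `[-M, M)` in the currency `ω_n = (2n+1)π/β`;
* §5 `norm_sum_matsubaraIdx_sub_tsum_le` (generic: `‖f(ω_n)‖ ≤ C/ω_n²` ⇒ `‖Σ_{MatsubaraIdx M} f − Σ'_{ℤ} f‖ ≤ Cβ²/(2π²M)`, via
  `…ScaleZeroMatsubaraWindowTruncation`) and **`norm_sum_freqTerm_sub_tsum_le_of_ne_zero`** — (M): OFF SITE the engine's `2M`-frequency window of the
  scale-`0` covariance entry differs from the full Matsubara series by at most `(2B₁+1)·E·β/(2π²M)`, uniformly in `L` and in the times, and the full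
  series converges absolutely (so that `Literature.Analysis.Fourier.fermionicMatsubaraSum_eq_tsum_images` applies to it: SPEC v2 (β1) = (M) ∘ D3);
* §6 (appended) `hasSum_int_one_div_matsubara_sq_add_sq`, **`tsum_int_one_div_beta_mul_max_sq_le`** — `Σ_{n∈ℤ} 1/(β·max(|ω_n|,a)²) ≤ tanh(βa/2)/a ≤ 1/a`
  (β-UNIFORM; `Literature.Analysis.SpecialFunctions.tsum_int_one_div_matsubara_sq_add_sq`), and **`tsum_norm_freqTerm_le_of_ne_zero`** — the off-site
  frequency series of the scale-`0` covariance entry converges absolutely with the `β`- and `L`-uniform bound `(2B₁+1)·E·(2/Λ)`.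

Proofs only; no definitions; nothing here asserts (C), any stub of 20437, K3 or superconductivity.  References: BGM 2006 §2.1 (2.3)–(2.4), (2.36aa)
[cite: BenfattoGiulianiMastropietro2006]; Salmhofer 1999 §4.2.4 (4.63), §4.2.5 (4.70) [cite: Salmhofer1999].
-/

noncomputable section

namespace Summit.HubbardSuperconductivity.HubbardSuperconductivity.Theorems.KLRegimeSplit

set_option linter.dupNamespace false -- summit = problem name (single-conjunct summit), D-0017

open Literature.MathematicalPhysics.QuantumLattice Literature.Probability.LatticeModels Literature.Analysis.SpecialFunctions
open Finset Complex Real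

variable {L : ℕ} [NeZero L]

/-! ## §1 Off site, a momentum-independent symbol is invisible -/

/-- **Off site any reference value may be subtracted**: for `x ≠ 0` in the torus, `Σ_k χ_k(x)·F(k) = Σ_k χ_k(x)·(F(k) − a)`
(character orthogonality `Σ_k χ_k(x) = 0`, `sum_torusChar_left`). -/
theorem sum_torusChar_mul_eq_sum_torusChar_mul_sub {d : ℕ} (F : TorusSite d L → ℂ) (a : ℂ) {x : TorusSite d L} (hx : x ≠ 0) :
    ∑ k, torusChar k x * F k = ∑ k, torusChar k x * (F k - a) := by
  simp only [mul_sub, Finset.sum_sub_distrib, ← Finset.sum_mul, sum_torusChar_left, if_neg hx, zero_mul, sub_zero]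

/-- **Off-site momentum sums see only the oscillation of the symbol**: for `x ≠ 0`, `‖Σ_k χ_k(x)·F(k)‖ ≤ Σ_k ‖F(k) − a‖` for every `a`. -/
theorem norm_sum_torusChar_mul_le_of_ne_zero {d : ℕ} (F : TorusSite d L → ℂ) (a : ℂ) {x : TorusSite d L} (hx : x ≠ 0) :
    ‖∑ k, torusChar k x * F k‖ ≤ ∑ k, ‖F k - a‖ := by
  rw [sum_torusChar_mul_eq_sum_torusChar_mul_sub F a hx]
  refine (norm_sum_le _ _).trans (Finset.sum_le_sum fun k _ => ?_)
  rw [norm_mul, norm_torusChar, one_mul]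

/-! ## §2 The UV symbol is Lipschitz in the band, with constant `(2B₁+1)c/m(ω)²` -/

/-- **Band-Lipschitz bound of the UV symbol**: `‖Ψ(ω,e) − Ψ(ω,e′)‖ ≤ (2B₁+1)·c/m(ω)²·|e − e′|` for every real `ω`, `m(ω) = max(|ω|, Λ/2)`
(mean value with `norm_uvSymbolFnXiD1_le`; `0 ≤ c`, `0 < Λ`, `|χ₂′| ≤ B₁`). -/
theorem norm_uvSymbolFn_sub_uvSymbolFn_le {c Λ : ℝ} (hc : 0 ≤ c) (hΛ : 0 < Λ) {B₁ : ℝ} (hB₁ : ∀ x, |deriv salmhoferCutoff x| ≤ B₁)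
    (e e' ω : ℝ) :
    ‖uvSymbolFn c Λ e ω - uvSymbolFn c Λ e' ω‖ ≤ (2 * B₁ + 1) * c / max |ω| (Λ / 2) ^ 2 * |e - e'| := by
  simp only [uvSymbolFn_eq_uvSymbolFnXi]
  have h := convex_univ.norm_image_sub_le_of_norm_hasDerivWithin_le (f := uvSymbolFnXi c Λ ω) (f' := uvSymbolFnXiD1 c Λ ω)
    (fun x _ => (hasDerivAt_uvSymbolFnXi hΛ x).hasDerivWithinAt) (fun x _ => norm_uvSymbolFnXiD1_le hΛ hc hB₁ x)
    (Set.mem_univ e') (Set.mem_univ e)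
  rwa [Real.norm_eq_abs] at h

/-! ## §3 The spatial factor of every frequency is `O(1/m(ω)²)` off site, uniformly in `L` -/

/-- **Off-site per-frequency size of the spatial factor, uniformly in `L`**: for `x ≠ 0` in the torus and a band `|e(k)| ≤ E`,
`‖Σ_k χ_k(x)·Ψ(ω, e(k))‖ ≤ L²·((2B₁+1)·c/m(ω)²·E)` for EVERY real `ω` — the `1/ω`-sized, momentum-independent part of the UV symbol is spatially
local and never reaches an off-site entry. -/
theorem norm_sum_torusChar_mul_uvSymbolFn_le_of_ne_zero {c Λ : ℝ} (hc : 0 ≤ c) (hΛ : 0 < Λ) {B₁ : ℝ} (hB₁ : ∀ x, |deriv salmhoferCutoff x| ≤ B₁)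
    (e : TorusSite 2 L → ℝ) {E : ℝ} (hE : ∀ k, |e k| ≤ E) (ω : ℝ) {x : TorusSite 2 L} (hx : x ≠ 0) :
    ‖∑ k, torusChar k x * uvSymbolFn c Λ (e k) ω‖ ≤ (L : ℝ) ^ 2 * ((2 * B₁ + 1) * c / max |ω| (Λ / 2) ^ 2 * E) := by
  refine (norm_sum_torusChar_mul_le_of_ne_zero _ (uvSymbolFn c Λ 0 ω) hx).trans ?_
  have hB10 : 0 ≤ B₁ := (abs_nonneg _).trans (hB₁ 0)
  have hK : 0 ≤ (2 * B₁ + 1) * c / max |ω| (Λ / 2) ^ 2 := by positivity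
  calc ∑ k, ‖uvSymbolFn c Λ (e k) ω - uvSymbolFn c Λ 0 ω‖
      ≤ ∑ _k : TorusSite 2 L, (2 * B₁ + 1) * c / max |ω| (Λ / 2) ^ 2 * E := by
        refine Finset.sum_le_sum fun k _ => (norm_uvSymbolFn_sub_uvSymbolFn_le hc hΛ hB₁ (e k) 0 ω).trans ?_
        rw [sub_zero]
        exact mul_le_mul_of_nonneg_left (hE k) hK
    _ = (L : ℝ) ^ 2 * ((2 * B₁ + 1) * c / max |ω| (Λ / 2) ^ 2 * E) := by
        have hcard : (Fintype.card (TorusSite 2 L) : ℝ) = (L : ℝ) ^ 2 := by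
          rw [Fintype.card_fun, ZMod.card, Fintype.card_fin]; push_cast; ring
        rw [Finset.sum_const, Finset.card_univ, nsmul_eq_mul, hcard]

/-- **The frequency term of the scale-`0` covariance entry off site**: in the normalisation of `gridCov_uvSymbolCT_apply_zero_one_eq_sum_freq`
(`c = βL²`), for `x ≠ 0`, `0 < β`, `|e(k)| ≤ E` and every real `ω`, `Δτ`:
`‖(1/(βL²))²·e^{iωΔτ}·Σ_k χ_k(x)Ψ(ω, e(k))‖ ≤ (2B₁+1)·E/(β·m(ω)²)`. -/
theorem norm_freqTerm_le_of_ne_zero {Λ : ℝ} (hΛ : 0 < Λ) {B₁ : ℝ} (hB₁ : ∀ x, |deriv salmhoferCutoff x| ≤ B₁) {β : ℝ} (hβ : 0 < β)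
    (e : TorusSite 2 L → ℝ) {E : ℝ} (hE : ∀ k, |e k| ≤ E) (ω Δτ : ℝ) {x : TorusSite 2 L} (hx : x ≠ 0) :
    ‖((1 / (β * (L : ℝ) ^ 2) : ℝ) : ℂ) ^ 2 * cexp (I * ((ω * Δτ : ℝ) : ℂ)) *
        ∑ k, torusChar k x * uvSymbolFn (β * (L : ℝ) ^ 2) Λ (e k) ω‖ ≤ (2 * B₁ + 1) * E / (β * max |ω| (Λ / 2) ^ 2) := by
  have hL : (0 : ℝ) < (L : ℝ) := Nat.cast_pos.2 (Nat.pos_of_ne_zero (NeZero.ne L))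
  have hc : 0 ≤ β * (L : ℝ) ^ 2 := by positivity
  have hm : 0 < max |ω| (Λ / 2) := lt_max_of_lt_right (by positivity)
  have hexp : ‖cexp (I * ((ω * Δτ : ℝ) : ℂ))‖ = 1 := by
    rw [mul_comm, Complex.norm_exp_ofReal_mul_I]
  rw [norm_mul, norm_mul, hexp, mul_one, norm_pow, Complex.norm_real, Real.norm_eq_abs, abs_of_nonneg (by positivity)]
  calc (1 / (β * (L : ℝ) ^ 2)) ^ 2 * ‖∑ k, torusChar k x * uvSymbolFn (β * (L : ℝ) ^ 2) Λ (e k) ω‖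
      ≤ (1 / (β * (L : ℝ) ^ 2)) ^ 2 * ((L : ℝ) ^ 2 * ((2 * B₁ + 1) * (β * (L : ℝ) ^ 2) / max |ω| (Λ / 2) ^ 2 * E)) :=
        mul_le_mul_of_nonneg_left (norm_sum_torusChar_mul_uvSymbolFn_le_of_ne_zero hc hΛ hB₁ e hE ω hx) (by positivity)
    _ = (2 * B₁ + 1) * E / (β * max |ω| (Λ / 2) ^ 2) := by
        field_simp

/-! ## §4 The engine's frequency set `MatsubaraIdx M` is the integer window `[-M, M)` -/

/-- **Re-indexing**: a sum over the `2M` kept frequencies `ω_i = π(2(i−M)+1)/β`, `i : MatsubaraIdx M`, is the sum over the integer window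
`n ∈ [-M, M)` of `f((2n+1)π/β)` (the currency of `Literature.Analysis.Fourier.fermionicMatsubaraSum_eq_tsum_images`). -/
theorem sum_matsubaraIdx_freq_eq_sum_Ico {α : Type*} [AddCommMonoid α] (β : ℝ) (M : ℕ) (f : ℝ → α) :
    ∑ i : MatsubaraIdx M, f (matsubaraFreq β M i) = ∑ n ∈ Finset.Ico (-(M : ℤ)) M, f ((2 * n + 1) * π / β) := by
  have himage : Finset.Ico (-(M : ℤ)) M = (range (2 * M)).image fun j : ℕ => (j : ℤ) - M := by
    ext n
    simp only [Finset.mem_Ico, Finset.mem_image, Finset.mem_range]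
    constructor
    · rintro ⟨h1, h2⟩
      exact ⟨(n + M).toNat, by omega, by omega⟩
    · rintro ⟨j, hj, rfl⟩
      omega
  have hinj : Set.InjOn (fun j : ℕ => (j : ℤ) - M) (range (2 * M) : Finset ℕ) := by
    intro a _ b _ h
    have : (a : ℤ) = b := by simpa using h
    exact_mod_cast this
  rw [himage, Finset.sum_image hinj, ← Fin.sum_univ_eq_sum_range]
  refine Finset.sum_congr rfl fun i _ => ?_
  simp only [matsubaraFreq, matsubaraInt]
  push_cast
  ring_nf


/-! ## §5 (M): the engine's frequency window versus the full Matsubara series, off site -/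

/-- **Window truncation at the Matsubara frequencies, generic**: if `‖f(ω_n)‖ ≤ C/ω_n²` at every `ω_n = (2n+1)π/β` (`β > 0`, `M ≥ 1`), then
`n ↦ f(ω_n)` is summable over `ℤ` and `‖Σ_{i : MatsubaraIdx M} f(ω_i) − Σ'_{n ∈ ℤ} f(ω_n)‖ ≤ C·β²/(2π²M)`
(`…ScaleZeroMatsubaraWindowTruncation.norm_tsum_sub_sum_Ico_le_of_norm_le` after `sum_matsubaraIdx_freq_eq_sum_Ico`). -/
theorem norm_sum_matsubaraIdx_sub_tsum_le {E' : Type*} [NormedAddCommGroup E'] [CompleteSpace E'] (f : ℝ → E') {β : ℝ} (hβ : 0 < β)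
    {M : ℕ} (hM : 0 < M) {C : ℝ} (hC : ∀ n : ℤ, ‖f ((2 * n + 1) * π / β)‖ ≤ C / ((2 * n + 1) * π / β) ^ 2) :
    Summable (fun n : ℤ => f ((2 * n + 1) * π / β)) ∧
    ‖∑ i : MatsubaraIdx M, f (matsubaraFreq β M i) - ∑' n : ℤ, f ((2 * n + 1) * π / β)‖ ≤ C * β ^ 2 / (2 * π ^ 2 * M) := by
  have hπ := Real.pi_pos
  have key := norm_tsum_sub_sum_Ico_le_of_norm_le (F := fun n : ℤ => f ((2 * n + 1) * π / β)) hM (A := C * β ^ 2 / π ^ 2)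
    (fun n _ => (hC n).trans (le_of_eq (by
      have hodd : (2 * (n : ℝ) + 1) ≠ 0 := by
        have : (2 * (n : ℝ) + 1) = ((2 * n + 1 : ℤ) : ℝ) := by push_cast; ring
        rw [this]; exact_mod_cast (by omega : (2 * n + 1 : ℤ) ≠ 0)
      field_simp)))
  refine ⟨key.1, ?_⟩
  rw [sum_matsubaraIdx_freq_eq_sum_Ico, norm_sub_rev]
  refine key.2.trans (le_of_eq ?_)
  have hM' : (0 : ℝ) < M := by exact_mod_cast hM
  field_simp

/-- **(M) OFF SITE — the engine's `2M`-frequency window differs from the full Matsubara series by `O(β/M)`, uniformly in `L` and in the times**: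
for `x ≠ 0` in the torus, `0 < β`, `1 ≤ M`, a band `|e(k)| ≤ E`, the cutoff table `|χ₂′| ≤ B₁`, and every real `Δτ`, the frequency terms
`F(ω) = (βL²)⁻²·e^{iωΔτ}·Σ_k χ_k(x)Ψ(ω, e(k))` of `gridCov_uvSymbolCT_apply_zero_one_eq_sum_freq` (`c = βL²`) satisfy: `n ↦ F(ω_n)` is summable
over `ℤ`, and `‖Σ_{i : MatsubaraIdx M} F(ω_i) − Σ'_{n ∈ ℤ} F(ω_n)‖ ≤ (2B₁+1)·E·β/(2π²M)` (`ω_n = (2n+1)π/β`). -/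
theorem norm_sum_freqTerm_sub_tsum_le_of_ne_zero {Λ : ℝ} (hΛ : 0 < Λ) {B₁ : ℝ} (hB₁ : ∀ x, |deriv salmhoferCutoff x| ≤ B₁) {β : ℝ}
    (hβ : 0 < β) {M : ℕ} (hM : 0 < M) (e : TorusSite 2 L → ℝ) {E : ℝ} (hE : ∀ k, |e k| ≤ E) (Δτ : ℝ) {x : TorusSite 2 L} (hx : x ≠ 0) :
    Summable (fun n : ℤ => ((1 / (β * (L : ℝ) ^ 2) : ℝ) : ℂ) ^ 2 * cexp (I * (((2 * n + 1) * π / β * Δτ : ℝ) : ℂ)) *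
        ∑ k, torusChar k x * uvSymbolFn (β * (L : ℝ) ^ 2) Λ (e k) ((2 * n + 1) * π / β)) ∧
    ‖∑ i : MatsubaraIdx M, ((1 / (β * (L : ℝ) ^ 2) : ℝ) : ℂ) ^ 2 * cexp (I * ((matsubaraFreq β M i * Δτ : ℝ) : ℂ)) *
          ∑ k, torusChar k x * uvSymbolFn (β * (L : ℝ) ^ 2) Λ (e k) (matsubaraFreq β M i) -
        ∑' n : ℤ, ((1 / (β * (L : ℝ) ^ 2) : ℝ) : ℂ) ^ 2 * cexp (I * (((2 * n + 1) * π / β * Δτ : ℝ) : ℂ)) *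
          ∑ k, torusChar k x * uvSymbolFn (β * (L : ℝ) ^ 2) Λ (e k) ((2 * n + 1) * π / β)‖ ≤
      (2 * B₁ + 1) * E * β / (2 * π ^ 2 * M) := by
  set F : ℝ → ℂ := fun ω => ((1 / (β * (L : ℝ) ^ 2) : ℝ) : ℂ) ^ 2 * cexp (I * ((ω * Δτ : ℝ) : ℂ)) *
    ∑ k, torusChar k x * uvSymbolFn (β * (L : ℝ) ^ 2) Λ (e k) ω with hF
  have hπ := Real.pi_pos
  have hB10 : 0 ≤ B₁ := (abs_nonneg _).trans (hB₁ 0)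
  have hE0 : 0 ≤ E := (abs_nonneg _).trans (hE 0)
  have hC : ∀ n : ℤ, ‖F ((2 * n + 1) * π / β)‖ ≤ (2 * B₁ + 1) * E / β / ((2 * n + 1) * π / β) ^ 2 := fun n => by
    have h := norm_freqTerm_le_of_ne_zero hΛ hB₁ hβ e hE ((2 * n + 1) * π / β) Δτ hx
    refine h.trans ?_
    have hodd : (2 * (n : ℝ) + 1) ≠ 0 := by
      have : (2 * (n : ℝ) + 1) = ((2 * n + 1 : ℤ) : ℝ) := by push_cast; ring
      rw [this]; exact_mod_cast (by omega : (2 * n + 1 : ℤ) ≠ 0)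
    have hω : 0 < |(2 * n + 1) * π / β| := by
      rw [abs_pos]; exact div_ne_zero (mul_ne_zero hodd Real.pi_ne_zero) hβ.ne'
    have hm : |(2 * n + 1) * π / β| ≤ max |(2 * n + 1) * π / β| (Λ / 2) := le_max_left _ _
    calc (2 * B₁ + 1) * E / (β * max |(2 * n + 1) * π / β| (Λ / 2) ^ 2)
        ≤ (2 * B₁ + 1) * E / (β * |(2 * n + 1) * π / β| ^ 2) := by
          apply div_le_div_of_nonneg_left (by positivity) (by positivity)
          exact mul_le_mul_of_nonneg_left (pow_le_pow_left₀ hω.le hm 2) hβ.le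
      _ = (2 * B₁ + 1) * E / β / ((2 * n + 1) * π / β) ^ 2 := by
          rw [sq_abs]
          field_simp
  obtain ⟨h1, h2⟩ := norm_sum_matsubaraIdx_sub_tsum_le F hβ hM hC
  refine ⟨by simpa only [hF] using h1, ?_⟩
  have hM' : (0 : ℝ) < M := by exact_mod_cast hM
  have h3 : (2 * B₁ + 1) * E / β * β ^ 2 / (2 * π ^ 2 * M) = (2 * B₁ + 1) * E * β / (2 * π ^ 2 * M) := by
    field_simp
  rw [h3] at h2
  simpa only [hF] using h2

/-! ## §6 The off-site sizes are summable over ALL Matsubara frequencies, uniformly in `β` -/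

/-- The two-sided Matsubara sum `Σ_{n ∈ ℤ} 1/(ω_n² + a²) = β·tanh(βa/2)/(2a)` as a `HasSum` statement (`β > 0`, `a ≠ 0`;
`Literature.Analysis.SpecialFunctions.tsum_int_one_div_matsubara_sq_add_sq`). -/
theorem hasSum_int_one_div_matsubara_sq_add_sq {β a : ℝ} (hβ : 0 < β) (ha : a ≠ 0) :
    HasSum (fun n : ℤ => 1 / (((2 * n + 1) * π / β) ^ 2 + a ^ 2)) (β * Real.tanh (β * a / 2) / (2 * a)) := by
  have hs := summable_one_div_matsubara_sq_add_sq hβ a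
  have hv := tsum_one_div_matsubara_sq_add_sq hβ ha
  have h0 : HasSum (fun n : ℕ => 1 / (((2 * n + 1) * π / β) ^ 2 + a ^ 2)) (β * Real.tanh (β * a / 2) / (4 * a)) := by
    rw [← hv]; exact hs.hasSum
  set f : ℤ → ℝ := fun n => 1 / (((2 * n + 1) * π / β) ^ 2 + a ^ 2) with hf
  have hf1 : (fun n : ℕ => f n) = fun n : ℕ => 1 / (((2 * n + 1) * π / β) ^ 2 + a ^ 2) := by
    funext n; rw [hf]; push_cast; ring_nf
  have hf2 : (fun n : ℕ => f (-(n + 1))) = fun n : ℕ => 1 / (((2 * n + 1) * π / β) ^ 2 + a ^ 2) := by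
    funext n; rw [hf]; push_cast; ring_nf
  have h1 : HasSum (fun n : ℕ => f n) (β * Real.tanh (β * a / 2) / (4 * a)) := by rw [hf1]; exact h0
  have h2 : HasSum (fun n : ℕ => f (-(n + 1))) (β * Real.tanh (β * a / 2) / (4 * a)) := by rw [hf2]; exact h0
  have h := HasSum.of_nat_of_neg_add_one h1 h2
  convert h using 1
  ring

/-- **`β`-uniform frequency sum of the off-site envelope**: for `β > 0`, `a > 0`, with `ω_n = (2n+1)π/β`,
`Σ_{n ∈ ℤ} 1/(β·max(|ω_n|, a)²) ≤ tanh(βa/2)/a ≤ 1/a` (`max(|ω|,a)² ≥ (ω²+a²)/2` and the two-sided Matsubara sum) — the per-frequency off-site sizes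
`(2B₁+1)E/(β·m(ω_n)²)` of `norm_freqTerm_le_of_ne_zero` (`a = Λ/2`) sum to at most `(2B₁+1)E·2/Λ`, uniformly in `β`. -/
theorem tsum_int_one_div_beta_mul_max_sq_le {β a : ℝ} (hβ : 0 < β) (ha : 0 < a) :
    Summable (fun n : ℤ => 1 / (β * max |(2 * n + 1) * π / β| a ^ 2)) ∧
    ∑' n : ℤ, 1 / (β * max |(2 * n + 1) * π / β| a ^ 2) ≤ 1 / a := by
  have hg := hasSum_int_one_div_matsubara_sq_add_sq hβ ha.ne'
  set g : ℤ → ℝ := fun n => (2 / β) * (1 / (((2 * n + 1) * π / β) ^ 2 + a ^ 2)) with hgdef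
  have hgs : HasSum g ((2 / β) * (β * Real.tanh (β * a / 2) / (2 * a))) := hg.mul_left (2 / β)
  have hle : ∀ n : ℤ, 1 / (β * max |(2 * n + 1) * π / β| a ^ 2) ≤ g n := fun n => by
    have hm : 0 < max |(2 * (n : ℝ) + 1) * π / β| a := lt_max_of_lt_right ha
    have hmax : ((2 * (n : ℝ) + 1) * π / β) ^ 2 + a ^ 2 ≤ 2 * max |(2 * (n : ℝ) + 1) * π / β| a ^ 2 := by
      have h1 : ((2 * (n : ℝ) + 1) * π / β) ^ 2 ≤ max |(2 * (n : ℝ) + 1) * π / β| a ^ 2 := by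
        rw [← sq_abs ((2 * (n : ℝ) + 1) * π / β)]
        exact pow_le_pow_left₀ (abs_nonneg _) (le_max_left _ _) 2
      have h2 : a ^ 2 ≤ max |(2 * (n : ℝ) + 1) * π / β| a ^ 2 := pow_le_pow_left₀ ha.le (le_max_right _ _) 2
      linarith
    rw [hgdef]
    push_cast
    rw [div_mul_eq_mul_div, mul_one_div, div_div, div_le_div_iff₀ (by positivity) (by positivity)]
    nlinarith [hβ]
  have hnn : ∀ n : ℤ, 0 ≤ 1 / (β * max |(2 * n + 1) * π / β| a ^ 2) := fun n => by positivity
  have hfs : Summable (fun n : ℤ => 1 / (β * max |(2 * n + 1) * π / β| a ^ 2)) := Summable.of_nonneg_of_le hnn hle hgs.summable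
  refine ⟨hfs, ?_⟩
  calc ∑' n : ℤ, 1 / (β * max |(2 * n + 1) * π / β| a ^ 2) ≤ ∑' n : ℤ, g n := hfs.tsum_le_tsum hle hgs.summable
    _ = (2 / β) * (β * Real.tanh (β * a / 2) / (2 * a)) := hgs.tsum_eq
    _ = Real.tanh (β * a / 2) / a := by field_simp
    _ ≤ 1 / a := div_le_div_of_nonneg_right (Real.tanh_lt_one _).le ha.le

/-- **The off-site frequency series of the scale-`0` covariance converges absolutely with a `β`- and `L`-UNIFORM bound**: for `x ≠ 0` in the torus,
`0 < β`, `0 < Λ`, `|e(k)| ≤ E`, `|χ₂′| ≤ B₁`, and every real `Δτ`,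
`Σ_{n ∈ ℤ} ‖(βL²)⁻²·e^{iω_nΔτ}·Σ_k χ_k(x)Ψ(ω_n, e(k))‖ ≤ (2B₁+1)·E·(2/Λ)` (crude, but uniform: the bound that makes every
tail-with-a-small-prefactor argument — window truncation, torus comparison — run over the full frequency series). -/
theorem tsum_norm_freqTerm_le_of_ne_zero {Λ : ℝ} (hΛ : 0 < Λ) {B₁ : ℝ} (hB₁ : ∀ x, |deriv salmhoferCutoff x| ≤ B₁) {β : ℝ} (hβ : 0 < β)
    (e : TorusSite 2 L → ℝ) {E : ℝ} (hE : ∀ k, |e k| ≤ E) (Δτ : ℝ) {x : TorusSite 2 L} (hx : x ≠ 0) :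
    Summable (fun n : ℤ => ‖((1 / (β * (L : ℝ) ^ 2) : ℝ) : ℂ) ^ 2 * cexp (I * (((2 * n + 1) * π / β * Δτ : ℝ) : ℂ)) *
        ∑ k, torusChar k x * uvSymbolFn (β * (L : ℝ) ^ 2) Λ (e k) ((2 * n + 1) * π / β)‖) ∧
    ∑' n : ℤ, ‖((1 / (β * (L : ℝ) ^ 2) : ℝ) : ℂ) ^ 2 * cexp (I * (((2 * n + 1) * π / β * Δτ : ℝ) : ℂ)) *
        ∑ k, torusChar k x * uvSymbolFn (β * (L : ℝ) ^ 2) Λ (e k) ((2 * n + 1) * π / β)‖ ≤ (2 * B₁ + 1) * E * (2 / Λ) := by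
  have hB10 : 0 ≤ B₁ := (abs_nonneg _).trans (hB₁ 0)
  have hE0 : 0 ≤ E := (abs_nonneg _).trans (hE 0)
  obtain ⟨hs, hle⟩ := tsum_int_one_div_beta_mul_max_sq_le hβ (half_pos hΛ)
  set g : ℤ → ℝ := fun n => (2 * B₁ + 1) * E * (1 / (β * max |(2 * n + 1) * π / β| (Λ / 2) ^ 2)) with hgdef
  have hgs : Summable g := hs.mul_left _
  have hbound : ∀ n : ℤ, ‖((1 / (β * (L : ℝ) ^ 2) : ℝ) : ℂ) ^ 2 * cexp (I * (((2 * n + 1) * π / β * Δτ : ℝ) : ℂ)) *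
      ∑ k, torusChar k x * uvSymbolFn (β * (L : ℝ) ^ 2) Λ (e k) ((2 * n + 1) * π / β)‖ ≤ g n := fun n => by
    have h := norm_freqTerm_le_of_ne_zero hΛ hB₁ hβ e hE ((2 * n + 1) * π / β) Δτ hx
    refine h.trans (le_of_eq ?_)
    rw [hgdef]
    push_cast
    ring
  have hfs := Summable.of_nonneg_of_le (fun n => norm_nonneg _) hbound hgs
  refine ⟨hfs, (hfs.tsum_le_tsum hbound hgs).trans ?_⟩
  rw [hgdef, tsum_mul_left]
  calc (2 * B₁ + 1) * E * ∑' n : ℤ, 1 / (β * max |(2 * (n : ℝ) + 1) * π / β| (Λ / 2) ^ 2)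
      ≤ (2 * B₁ + 1) * E * (1 / (Λ / 2)) := mul_le_mul_of_nonneg_left hle (by positivity)
    _ = (2 * B₁ + 1) * E * (2 / Λ) := by rw [one_div_div]

end Summit.HubbardSuperconductivity.HubbardSuperconductivity.Theorems.KLRegimeSplit

end
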